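import Literature.RepresentationTheory.FiniteGroups.SymmetricGroupSignStandardCharacters
import Literature.Computability.AlgebraicComplexity.LMR13ZariskiTangentProofs
import HarnessLib

/-!
# Landsberg–Manivel–Ressayre 2013, Prop. 3.4.2, the `⊇` half: `IM_{1ⁿ} = det_n` and `IM_{21^{n−2}}`
# lie in `T̂_{[det_n]}𝒟ual_{2n−2,n,n²}` — PROVED

Cell `val-lit` (D-0074), row `LMR13-A`, typer/prover `val-lit-t11` (g2). Theorem-only companion of
`LMR13DualVarieties.lean` (no definitions, no named facts). LMR 2013 §3.4 (journal pp. 478–479,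
`paper:galaxy-pdf-8572435590081880720 p0010.txt:L1–12, p0011.txt:L23`; arXiv `p0007.txt:L44–52`,
`p0008.txt:L8`): "`λ` belongs to `P_n` if and only if `IM_λ` belongs to `T̂_{[det_n]}𝒟ual_{2n−2,n,n²}`
… Proposition 3.4.2. `P_n = {1ⁿ, 21^{n−2}}`." The typed fact `LMR2013_prop_3_4_2` is the `iff`; this
file PROVES the direction `⊇` — `LMR2013_prop_3_4_2_mpr`: for `n ≥ 3` and `λ ⊢ n` with parts `(1ⁿ)`
or `(2,1^{n−2})`, `immanant λ ∈ lmrZariskiTangent (2n−2) n det_n`. The direction `⊆` (no other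
immanant is tangent — the character computation of LMR Lemmas 3.3.1, 3.3.2, 3.4.1) stays in the
fact.

## The argument (the printed one, p. 479: "`IM_{1ⁿ} = det_n` … `𝔤𝔩(W)·det_n ⊂ T̂`")

* `detPoly_eq_sum_sign_smul_prod`: `det_n = Σ_σ sgn σ · ∏_i x_{iσ(i)}` (row-indexed Leibniz,
  `Matrix.det_transpose` + `Matrix.det_apply'`).
* `immanant_indiscrete_transpose`: **`IM_{(1ⁿ)} = det_n`**, by `χ^{(1ⁿ)} = sgn`
  (`spechtCharacter_indiscrete_transpose`, `SymmetricGroupSignStandardCharacters.lean`).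
* `sum_X_mul_pderiv_diag_detPoly`: `Σ_j x_jj ∂_jj det_n = Σ_σ sgn σ · #fix(σ) · ∏_i x_{iσ(i)}` (the
  diagonal Euler operator counts fixed points on a permutation monomial,
  `sum_X_mul_pderiv_prod_perm`); hence `immanant_twoRow_one_transpose`:
  **`IM_{(2,1^{n−2})} = Σ_j x_jj ∂_jj det_n − det_n`** by `χ^{(2,1^{n−2})} = sgn·(#fix − 1)`
  (`spechtCharacter_twoRow_one_transpose`).
* Both lie in the orbit tangent space `𝔤𝔩(W)·det_n = span{x_b ∂_a det_n}` (`glTangent`;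
  `det_n = (1/n) Σ_p x_p ∂_p det_n` by Euler, `detPoly_mem_glTangent`), and
  `𝔤𝔩(W)·det_n ⊆ T̂_{[det_n]}𝒟ual` is `glTangent_detPoly_subset_lmrZariskiTangent`
  (`LMR13ZariskiTangentProofs.lean`).
* `eq_indiscrete_transpose_of_parts_eq`, `eq_twoRow_one_transpose_of_parts_eq`: the parts
  descriptions `replicate n 1` / `2 ::ₘ replicate (n−2) 1` used by the typed fact name the partitions
  `(n)ᵀ` and `(n−1,1)ᵀ` (column lengths via `getD_sortedParts_transpose`, `KroneckerPointSets.lean`).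

Honest framing: an elementary companion to a 2013 paper; **VP ≠ VNP is NOT proved and nothing here is
progress on it.**

## References

* [LandsbergManivelRessayre2013] J. M. Landsberg, L. Manivel, N. Ressayre, *Hypersurfaces with
  degenerate duals and the Geometric Complexity Theory Program*, Comment. Math. Helv. 88 (2013)
  469–484, §3.4 and Prop. 3.4.2 (pp. 478–479); arXiv:1004.4802.
* [FultonHarrisGTM129] W. Fulton, J. Harris, *Representation Theory*, GTM 129, §4.1 (sign and
  standard characters of `𝔖_n`).
-/

open MvPolynomial Literature.NumberTheory.DiophantineGeometry Literature.RepresentationTheory.FiniteGroups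
  Literature.Computability.AlgebraicComplexity

namespace Literature.Computability.AlgebraicComplexity

variable {n : ℕ}

/-- `det_n = Σ_σ sgn σ · ∏_i x_{iσ(i)}` — Leibniz with ROW-indexed monomials (`det M = det Mᵀ`), the
convention of `immanant`. [cite: LandsbergManivelRessayre2013, §3.4 (p. 478)] -/
theorem detPoly_eq_sum_sign_smul_prod :
    detPoly (Fin n) ℂ = ∑ σ : Equiv.Perm (Fin n),
      ((Equiv.Perm.sign σ : ℤ) : ℂ) • ∏ i : Fin n, (X (i, σ i) : MvPolynomial (Fin n × Fin n) ℂ) := by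
  rw [detPoly, ← Matrix.det_transpose, Matrix.det_apply']
  refine Finset.sum_congr rfl fun σ _ => ?_
  rw [MvPolynomial.smul_eq_C_mul, map_intCast]
  congr 1

/-- **`IM_{(1ⁿ)} = det_n`** ("`[1ⁿ]` is the sign representation and `IM_{(1ⁿ)}` is the determinant",
LMR 2013 §3.4, p. 478). [cite: LandsbergManivelRessayre2013, §3.4 (p. 478)] -/
theorem immanant_indiscrete_transpose :
    immanant (Nat.Partition.indiscrete n).transpose = detPoly (Fin n) ℂ := by
  rw [immanant, detPoly_eq_sum_sign_smul_prod]
  refine Finset.sum_congr rfl fun σ _ => ?_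
  rw [spechtCharacter_indiscrete_transpose]

/-- `x_p ∂_p` acts on a monomial by its exponent at `p` (Euler, one variable). [folklore] -/
private theorem X_mul_pderiv_monomial {σ : Type*} (p : σ) (s : σ →₀ ℕ) (a : ℂ) :
    X p * pderiv p (monomial s a) = (s p : ℂ) • monomial s a := by
  classical
  rw [pderiv_monomial]
  by_cases hs : s p = 0
  · rw [hs, Nat.cast_zero, mul_zero, monomial_zero, mul_zero, zero_smul]
  · rw [X, monomial_mul, one_mul, MvPolynomial.smul_monomial]
    congr 1
    · rw [add_comm, tsub_add_cancel_of_le]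
      exact Finsupp.single_le_iff.mpr (Nat.one_le_iff_ne_zero.mpr hs)
    · rw [smul_eq_mul, mul_comm]

/-- The diagonal Euler operator `Σ_j x_jj ∂_jj` multiplies the permutation monomial `∏_i x_{iσ(i)}` by
the number of fixed points of `σ`. [folklore] -/
private theorem sum_X_mul_pderiv_prod_perm (σ : Equiv.Perm (Fin n)) :
    ∑ j : Fin n, X (j, j) * pderiv (j, j) (∏ i : Fin n, (X (i, σ i) : MvPolynomial (Fin n × Fin n) ℂ)) =
      ((Finset.univ.filter fun p : Fin n => σ p = p).card : ℂ) •
        ∏ i : Fin n, (X (i, σ i) : MvPolynomial (Fin n × Fin n) ℂ) := by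
  classical
  have hmono : (∏ i : Fin n, (X (i, σ i) : MvPolynomial (Fin n × Fin n) ℂ)) =
      monomial (∑ i : Fin n, Finsupp.single (i, σ i) 1) 1 := by
    rw [monomial_sum_one]; rfl
  rw [hmono]
  simp_rw [X_mul_pderiv_monomial]
  rw [← Finset.sum_smul]
  congr 1
  rw [← Finset.sum_boole]
  refine Finset.sum_congr rfl fun j _ => ?_
  rw [Finset.sum_apply']
  rw [Finset.sum_eq_single j]
  · rw [Finsupp.single_apply]
    by_cases h : σ j = j
    · rw [if_pos (by rw [h]), if_pos h, Nat.cast_one]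
    · rw [if_neg (fun h' : (j, σ j) = (j, j) => h (Prod.mk.inj h').2), if_neg h, Nat.cast_zero]
  · intro i _ hij
    rw [Finsupp.single_apply, if_neg (fun h' : (i, σ i) = (j, j) => hij (Prod.mk.inj h').1)]
  · intro h; exact absurd (Finset.mem_univ j) h

/-- **`Σ_j x_jj ∂_jj det_n = Σ_σ sgn σ · #fix(σ) · ∏_i x_{iσ(i)}`** (LMR 2013 §3.4: the diagonal torus
direction of `𝔤𝔩(W)·det_n`). [cite: LandsbergManivelRessayre2013, §3.4 (p. 479)] -/
theorem sum_X_mul_pderiv_diag_detPoly :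
    ∑ j : Fin n, X (j, j) * pderiv (j, j) (detPoly (Fin n) ℂ) = ∑ σ : Equiv.Perm (Fin n),
      (((Equiv.Perm.sign σ : ℤ) : ℂ) * ((Finset.univ.filter fun p : Fin n => σ p = p).card : ℂ)) •
        ∏ i : Fin n, (X (i, σ i) : MvPolynomial (Fin n × Fin n) ℂ) := by
  classical
  rw [detPoly_eq_sum_sign_smul_prod]
  have h1 : ∀ j : Fin n, X (j, j) * pderiv (j, j) (∑ σ : Equiv.Perm (Fin n),
      ((Equiv.Perm.sign σ : ℤ) : ℂ) • ∏ i : Fin n, (X (i, σ i) : MvPolynomial (Fin n × Fin n) ℂ)) =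
      ∑ σ : Equiv.Perm (Fin n), ((Equiv.Perm.sign σ : ℤ) : ℂ) •
        (X (j, j) * pderiv (j, j) (∏ i : Fin n, (X (i, σ i) : MvPolynomial (Fin n × Fin n) ℂ))) := by
    intro j
    rw [map_sum, Finset.mul_sum]
    refine Finset.sum_congr rfl fun σ _ => ?_
    rw [MvPolynomial.smul_eq_C_mul, pderiv_C_mul, mul_left_comm, ← MvPolynomial.smul_eq_C_mul]
  simp_rw [h1]
  rw [Finset.sum_comm]
  refine Finset.sum_congr rfl fun σ _ => ?_
  rw [← Finset.smul_sum, sum_X_mul_pderiv_prod_perm, smul_smul]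

/-- **`IM_{(2,1^{n−2})} = Σ_j x_jj ∂_jj det_n − det_n`** (`n ≥ 2`), by `χ^{(2,1^{n−2})} = sgn · (#fix − 1)`
(`spechtCharacter_twoRow_one_transpose`). [cite: LandsbergManivelRessayre2013, §3.4 (p. 479)] -/
theorem immanant_twoRow_one_transpose (hn : 2 ≤ n) :
    immanant (Nat.Partition.twoRow n 1 (by omega)).transpose =
      ∑ j : Fin n, X (j, j) * pderiv (j, j) (detPoly (Fin n) ℂ) - detPoly (Fin n) ℂ := by
  rw [immanant, sum_X_mul_pderiv_diag_detPoly, detPoly_eq_sum_sign_smul_prod, ← Finset.sum_sub_distrib]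
  refine Finset.sum_congr rfl fun σ _ => ?_
  rw [spechtCharacter_twoRow_one_transpose hn, ← sub_smul, mul_sub, mul_one]

/-- **`det_n ∈ 𝔤𝔩(W)·det_n`** (`n ≥ 1`): Euler's identity `Σ_p x_p ∂_p det_n = n · det_n`
(`IsHomogeneous.sum_X_mul_pderiv`). [cite: LandsbergManivelRessayre2013, §3.3 (p. 477)] -/
theorem detPoly_mem_glTangent (hn : 1 ≤ n) : detPoly (Fin n) ℂ ∈ glTangent (detPoly (Fin n) ℂ) := by
  have hhom : (detPoly (Fin n) ℂ).IsHomogeneous n := by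
    simpa using detPoly_isHomogeneous (n := Fin n) (k := ℂ)
  have heuler := hhom.sum_X_mul_pderiv
  have hmem : ∑ p : Fin n × Fin n, X p * pderiv p (detPoly (Fin n) ℂ) ∈ glTangent (detPoly (Fin n) ℂ) :=
    Submodule.sum_mem _ fun p _ => Submodule.subset_span ⟨p, p, rfl⟩
  rw [heuler] at hmem
  have h := Submodule.smul_mem _ ((n : ℂ)⁻¹) hmem
  rwa [← Nat.cast_smul_eq_nsmul ℂ, smul_smul, inv_mul_cancel₀ (Nat.cast_ne_zero.mpr (by omega)),
    one_smul] at h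

/-- **`IM_{(2,1^{n−2})} ∈ 𝔤𝔩(W)·det_n`** (`n ≥ 2`): a combination of the generators `x_jj ∂_jj det_n` and of
`det_n`. [cite: LandsbergManivelRessayre2013, §3.4 (p. 479)] -/
theorem immanant_twoRow_one_transpose_mem_glTangent (hn : 2 ≤ n) :
    immanant (Nat.Partition.twoRow n 1 (by omega)).transpose ∈ glTangent (detPoly (Fin n) ℂ) := by
  rw [immanant_twoRow_one_transpose hn]
  refine Submodule.sub_mem _ (Submodule.sum_mem _ fun j _ => Submodule.subset_span ⟨(j, j), (j, j), rfl⟩)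
    (detPoly_mem_glTangent (by omega))

/-- **`IM_{(1ⁿ)} ∈ T̂_{[det_n]}𝒟ual_{2n−2,n,n²}`** (`n ≥ 3`; `det_n` itself is tangent,
`detPoly_mem_lmrZariskiTangent`). [cite: LandsbergManivelRessayre2013, Proposition 3.4.2 (p. 479)] -/
theorem immanant_indiscrete_transpose_mem_lmrZariskiTangent (hn : 3 ≤ n) :
    immanant (Nat.Partition.indiscrete n).transpose ∈
      lmrZariskiTangent (2 * n - 2) n (detPoly (Fin n) ℂ) := by
  rw [immanant_indiscrete_transpose]
  exact detPoly_mem_lmrZariskiTangent hn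

/-- **`IM_{(2,1^{n−2})} ∈ T̂_{[det_n]}𝒟ual_{2n−2,n,n²}`** (`n ≥ 3`; `𝔤𝔩(W)·det_n ⊆ T̂`,
`glTangent_detPoly_subset_lmrZariskiTangent`). [cite: LandsbergManivelRessayre2013, Proposition 3.4.2 (p. 479)] -/
theorem immanant_twoRow_one_transpose_mem_lmrZariskiTangent (hn : 3 ≤ n) :
    immanant (Nat.Partition.twoRow n 1 (by omega)).transpose ∈
      lmrZariskiTangent (2 * n - 2) n (detPoly (Fin n) ℂ) :=
  glTangent_detPoly_subset_lmrZariskiTangent hn (immanant_twoRow_one_transpose_mem_glTangent (by omega))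


/-! ### The parts descriptions `(1ⁿ)` and `(2,1^{n−2})` of the typed Prop. 3.4.2 -/

section Parts

/-- A partition with parts `1,…,1` is the column `(n)ᵀ = (1ⁿ)` (zero-padded rows via
`getD_sortedParts_indiscrete_transpose`). [cite: FultonHarrisGTM129, §4.1 (partitions and conjugates)] -/
theorem eq_indiscrete_transpose_of_parts_eq {lam : Nat.Partition n}
    (h : lam.parts = Multiset.replicate n 1) : lam = (Nat.Partition.indiscrete n).transpose := by
  have hl : lam.sortedParts = List.replicate n 1 := by
    refine List.eq_replicate_iff.mpr ⟨?_, fun b hb => ?_⟩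
    · rw [Nat.Partition.length_sortedParts, h, Multiset.card_replicate]
    · have hb' : b ∈ lam.parts := (Multiset.mem_sort _).mp hb
      rw [h] at hb'
      exact Multiset.eq_of_mem_replicate hb'
  refine Nat.Partition.ext (parts_eq_of_getD_sortedParts_eq fun i => ?_)
  rw [getD_sortedParts_indiscrete_transpose, hl]
  by_cases hi : i < n
  · rw [if_pos hi, List.getD_replicate _ hi]
  · rw [if_neg hi, List.getD_eq_default _ _ (by rw [List.length_replicate]; omega)]

/-- The sorted parts of a partition with parts `2,1,…,1` are `2 :: 1 :: ⋯ :: 1`. [folklore] -/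
private theorem sortedParts_of_parts_eq_hook {lam : Nat.Partition n}
    (h : lam.parts = 2 ::ₘ Multiset.replicate (n - 2) 1) :
    lam.sortedParts = 2 :: List.replicate (n - 2) 1 := by
  have hperm : lam.sortedParts.Perm (2 :: List.replicate (n - 2) 1) := by
    rw [← Multiset.coe_eq_coe, Nat.Partition.sortedParts, Multiset.sort_eq, h,
      ← Multiset.cons_coe, Multiset.coe_replicate]
  refine hperm.eq_of_sortedGE lam.sortedGE_sortedParts ?_
  rw [List.sortedGE_iff_pairwise, List.pairwise_cons]
  refine ⟨fun b hb => ?_, List.pairwise_replicate.mpr (Or.inr (le_refl 1))⟩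
  rw [List.eq_of_mem_replicate hb]
  decide

/-- A partition of `n ≥ 3` with parts `2,1,…,1` is the hook `(n−1,1)ᵀ = (2,1^{n−2})` (column lengths of
`(n−1,1)`: `2, 1, …, 1` with `n−2` ones). [cite: FultonHarrisGTM129, §4.1 (partitions and conjugates)] -/
theorem eq_twoRow_one_transpose_of_parts_eq (hn : 3 ≤ n) {lam : Nat.Partition n}
    (h : lam.parts = 2 ::ₘ Multiset.replicate (n - 2) 1) :
    lam = (Nat.Partition.twoRow n 1 (by omega)).transpose := by
  have hl := sortedParts_of_parts_eq_hook h
  have hrow : ∀ i : ℕ, (Nat.Partition.twoRow n 1 (by omega)).youngDiagram.rowLen i =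
      [n - 1, 1].getD i 0 := fun i => by
    rw [rowLen_youngDiagram, sortedParts_twoRow le_rfl (by omega)]
  -- column lengths of `(n−1, 1)`
  have hcol : ∀ j : ℕ, (Nat.Partition.twoRow n 1 (by omega)).youngDiagram.colLen j =
      if j = 0 then 2 else if j < n - 1 then 1 else 0 := by
    intro j
    set Y := (Nat.Partition.twoRow n 1 (by omega)).youngDiagram with hY
    have hmem : ∀ i : ℕ, (i, j) ∈ Y ↔ j < [n - 1, 1].getD i 0 := fun i => by
      rw [YoungDiagram.mem_iff_lt_rowLen, hrow]
    have key : ∀ e : ℕ, (∀ i, (i, j) ∈ Y ↔ i < e) → Y.colLen j = e := by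
      intro e he
      have h1 : ¬ e < Y.colLen j := fun hlt => (lt_irrefl e) ((he e).mp (YoungDiagram.mem_iff_lt_colLen.mpr hlt))
      rcases Nat.eq_zero_or_pos e with rfl | hpos
      · omega
      · have h2 : e - 1 < Y.colLen j := YoungDiagram.mem_iff_lt_colLen.mp ((he (e - 1)).mpr (by omega))
        omega
    apply key
    intro i
    rw [hmem]
    by_cases hj0 : j = 0
    · subst hj0
      rw [if_pos rfl]
      match i with
      | 0 => simp; omega
      | 1 => simp
      | (k + 2) => simp
    · rw [if_neg hj0]
      by_cases hj : j < n - 1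
      · rw [if_pos hj]
        match i with
        | 0 => simp; omega
        | 1 => simp; omega
        | (k + 2) => simp
      · rw [if_neg hj]
        match i with
        | 0 => simp; omega
        | 1 => simp; omega
        | (k + 2) => simp
  refine Nat.Partition.ext (parts_eq_of_getD_sortedParts_eq fun i => ?_)
  rw [getD_sortedParts_transpose, hcol, hl]
  match i with
  | 0 => simp
  | (k + 1) =>
    rw [List.getD_cons_succ, if_neg (Nat.succ_ne_zero k)]
    by_cases hk : k < n - 2
    · rw [List.getD_replicate _ hk, if_pos (by omega)]
    · rw [List.getD_eq_default _ _ (by rw [List.length_replicate]; omega), if_neg (by omega)]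

/-- **LMR 2013, Prop. 3.4.2, the `⊇` half — PROVED**: `{1ⁿ, 21^{n−2}} ⊆ P_n`, i.e. the immanants
`IM_{(1ⁿ)} = det_n` and `IM_{(2,1^{n−2})}` lie in `T̂_{[det_n]}𝒟ual_{2n−2,n,n²}` (`n ≥ 3`), in the
parts-description of the typed `LMR2013_prop_3_4_2` (whose `⊆` half — LMR Lemmas 3.3.1–3.4.1 — stays
FACT). [cite: LandsbergManivelRessayre2013, Proposition 3.4.2 (p. 479)] -/
theorem LMR2013_prop_3_4_2_mpr (hn : 3 ≤ n) (lam : Nat.Partition n)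
    (h : lam.parts = Multiset.replicate n 1 ∨ lam.parts = 2 ::ₘ Multiset.replicate (n - 2) 1) :
    immanant lam ∈ lmrZariskiTangent (2 * n - 2) n (detPoly (Fin n) ℂ) := by
  rcases h with h | h
  · rw [eq_indiscrete_transpose_of_parts_eq h]
    exact immanant_indiscrete_transpose_mem_lmrZariskiTangent hn
  · rw [eq_twoRow_one_transpose_of_parts_eq hn h]
    exact immanant_twoRow_one_transpose_mem_lmrZariskiTangent hn

end Parts

section WhatRemains

/-- **LMR 2013, Prop. 3.4.2 — what remains.** With the `⊇` half PROVED (`LMR2013_prop_3_4_2_mpr`),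
the named fact `LMR2013_prop_3_4_2` is EQUIVALENT to its `⊆` half: for `n ≥ 3`, an immanant `IM_λ`
tangent to `𝒟ual_{2n−2,n,n²}` at `det_n` has `λ ∈ {(1ⁿ), (2,1^{n−2})}` (the character computation of
LMR Lemmas 3.3.1, 3.3.2, 3.4.1, pp. 477–479). [cite: LandsbergManivelRessayre2013, Proposition 3.4.2 (p. 479)] -/
theorem LMR2013_prop_3_4_2_iff_subset :
    LMR2013_prop_3_4_2 ↔ ∀ (n : ℕ), 3 ≤ n → ∀ lam : Nat.Partition n,
      immanant lam ∈ lmrZariskiTangent (2 * n - 2) n (detPoly (Fin n) ℂ) →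
        lam.parts = Multiset.replicate n 1 ∨ lam.parts = 2 ::ₘ Multiset.replicate (n - 2) 1 := by
  refine forall₂_congr fun n hn => forall_congr' fun lam => ?_
  exact ⟨fun h => h.mp, fun h => ⟨h, LMR2013_prop_3_4_2_mpr hn lam⟩⟩

end WhatRemains

/-! ### Appendix (val-lit-p8 g3): the anchor `IM_{(n)} = per_n` -/

section Permanent

variable {n : ℕ}

/-- `per_n = Σ_σ ∏_i x_{iσ(i)}` — the permanent with ROW-indexed monomials (`per M = per Mᵀ`), the
convention of `immanant`. [cite: LandsbergManivelRessayre2013, §3.4 (p. 478)] -/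
theorem perPoly_eq_sum_prod :
    perPoly (Fin n) ℂ = ∑ σ : Equiv.Perm (Fin n),
      ∏ i : Fin n, (X (i, σ i) : MvPolynomial (Fin n × Fin n) ℂ) := by
  rw [perPoly, ← Matrix.permanent_transpose, Matrix.permanent]
  rfl

/-- **`IM_{(n)} = per_n`** ("`[n]` is the trivial representation and `IM_{(n)}` is the permanent",
LMR 2013 §3.4, p. 478): `χ^{(n)} ≡ 1` (`spechtCharacter_indiscrete`). Companion anchor of
`immanant_indiscrete_transpose` (`IM_{(1ⁿ)} = det_n`). [cite: LandsbergManivelRessayre2013, §3.4 (p. 478)] -/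
theorem immanant_indiscrete : immanant (Nat.Partition.indiscrete n) = perPoly (Fin n) ℂ := by
  rw [immanant, perPoly_eq_sum_prod]
  refine Finset.sum_congr rfl fun σ _ => ?_
  rw [Literature.Barriers.ValiantsHypothesis.spechtCharacter_indiscrete, one_smul]

/-- A partition of `n` with parts `{n}` is `(n)`. [folklore] -/
private theorem eq_indiscrete_of_parts_eq {lam : Nat.Partition n} (h : lam.parts = {n}) :
    lam = Nat.Partition.indiscrete n := by
  have hn : n ≠ 0 := (lam.parts_pos (by rw [h]; exact Multiset.mem_singleton_self n)).ne'
  ext1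
  rw [h, Nat.Partition.indiscrete_parts hn]

/-- `IM_λ = per_n` when `λ.parts = {n}` (the parts-description used by the typed statements).
[cite: LandsbergManivelRessayre2013, §3.4 (p. 478)] -/
theorem immanant_eq_perPoly_of_parts_eq {lam : Nat.Partition n} (h : lam.parts = {n}) :
    immanant lam = perPoly (Fin n) ℂ := by
  rw [eq_indiscrete_of_parts_eq h, immanant_indiscrete]

end Permanent

end Literature.Computability.AlgebraicComplexity
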